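import Summits.NavierStokesRegularity.NavierStokesRegularity.Theorems.SineMomentDoorDefs

/-!
# SineMomentDoorSpread — S27 «SineMomentDoor», the schema hypotheses (H1)–(H3)

Landing (DIRECTOR-NS #88/#89, typer g20) of nsreg-p1 g22's ROUND-26 door file `r26/Sketch27.lean`
(sha16 b3e45f4d288a9931; farm rc 0, 0 sorry) as theorems-only tree files, statements and proofs VERBATIM,
split along the planner's section boundaries: `SineMomentDoorDefs` (§0 observable, §1 texts, §0′ elementary facts),
`SineMomentDoorSpread` (§2 (H1) zoom-closedness, §3 (H2) analytic spread, §4 (H3) stratum Liouville),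
`SineMomentDoorDoors` (§5 the doors, §6 the transverse-vorticity corollary), `SineMomentDoorSeq` (§7 the sequential
upgrade). This file: (H1) `isWindowLsc_sinePhi`, (H2) `spreadsTo_sinePhi`, (H3) `stratumLiouville_uni`; see `SineMomentDoorDefs` for the planner's full account.
WHAT THIS IS NOT: not NS regularity (`NoTypeII` untouched); an ε-criterion inside the Type-I class, MODEL-free.
-/

noncomputable section

open MeasureTheory Set Function Filter Topology TopologicalSpace Metric
open scoped RealInnerProductSpace NNReal ENNReal Topology Pointwise ContDiff
open Literature.Analysis Literature.Analysis.FluidPDE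
open Summit.NavierStokesRegularity.NavierStokesRegularity.Theorems.PoloidalWindowDoorPoloidalWindowRigidityWindow
open Summit.NavierStokesRegularity.NavierStokesRegularity.Theorems.ZoomReturnDoorDefs
open Summit.NavierStokesRegularity.NavierStokesRegularity.Theorems.StableStrataDoorDefs
open Summit.NavierStokesRegularity.NavierStokesRegularity.Theorems.StableStrataDoorWindowLimit
open Summit.NavierStokesRegularity.NavierStokesRegularity.Theorems.StableStrataDoorSchema
open Summit.NavierStokesRegularity.NavierStokesRegularity.Theorems.StableStrataDoorInstances
open Summit.NavierStokesRegularity.NavierStokesRegularity.Theorems.LocalSineTubeDoorProfileAlignedWindowRigidity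
open Summit.NavierStokesRegularity.NavierStokesRegularity.Theorems.LocalSineTubeDoorProfileAlignedWindowRigidityPlanarity

set_option linter.dupNamespace false

namespace Summit.NavierStokesRegularity.NavierStokesRegularity.Theorems.SineMomentDoor

/-! ## §2 (H1) ZOOM-CLOSEDNESS of the sine-moment defect -/

/-- the truncated moments converge along pointwise limits of continuous fields (dominated convergence). -/
theorem tendsto_truncMoment {B : ℝ} (hB : 0 < B) {U : Set (EuclideanSpace ℝ (Fin 3))} {g : EuclideanSpace ℝ (Fin 3) → ℝ}
    (hg : IsTestWeight U g) {Fn : ℕ → EuclideanSpace ℝ (Fin 3) → EuclideanSpace ℝ (Fin 3)}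
    {F : EuclideanSpace ℝ (Fin 3) → EuclideanSpace ℝ (Fin 3)} (hFn : ∀ n, Continuous (Fn n))
    (hpt : ∀ y, Tendsto (fun n => Fn n y) atTop (𝓝 (F y))) :
    Tendsto (fun n => truncMoment B g (Fn n)) atTop (𝓝 (truncMoment B g F)) := by
  have hmeas : ∀ n, AEStronglyMeasurable (fun x => cross (truncate B (Fn n x)) (gradient g x)) volume := fun n =>
    (continuous_cross_comp ((continuous_truncate hB).comp (hFn n)) hg.continuous_gradient).aestronglyMeasurable
  have hbd : ∀ n, ∀ᵐ x ∂volume, ‖cross (truncate B (Fn n x)) (gradient g x)‖ ≤ B * ‖gradient g x‖ := fun n =>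
    Eventually.of_forall fun x =>
      (norm_cross_le_norm_mul_norm _ _).trans (mul_le_mul_of_nonneg_right (norm_truncate_le hB _) (norm_nonneg _))
  have hlim : ∀ᵐ x ∂volume, Tendsto (fun n => cross (truncate B (Fn n x)) (gradient g x)) atTop
      (𝓝 (cross (truncate B (F x)) (gradient g x))) :=
    Eventually.of_forall fun x =>
      tendsto_cross (((continuous_truncate hB).tendsto (F x)).comp (hpt x)) tendsto_const_nhds
  exact tendsto_integral_of_dominated_convergence (fun x => B * ‖gradient g x‖) hmeas (integrable_bound hg B) hbd hlim

/-- **(H1) for the sine-moment defect.** -/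
theorem isWindowLsc_sinePhi (U : Set (EuclideanSpace ℝ (Fin 3))) {B : ℝ} (hB : 0 < B) : IsWindowLsc (sinePhi U B) := by
  intro Fn F hFn _hF hpt
  by_cases hpen : ∀ ζ ∈ closure U, ‖F ζ‖ ≤ B
  · have hΦ : sinePhi U B F =
        ⨆ (g : EuclideanSpace ℝ (Fin 3) → ℝ) (h : EuclideanSpace ℝ (Fin 3) → ℝ) (_ : IsTestWeight U g) (_ : IsTestWeight U h),
          ENNReal.ofReal ‖cross (truncMoment B g F) (truncMoment B h F)‖ := by
      simp only [sinePhi, capPenalty, if_pos hpen, zero_add]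
    rw [hΦ]
    refine iSup_le fun g => iSup_le fun h => iSup_le fun hg => iSup_le fun hh => ?_
    have hconv : Tendsto (fun n => ENNReal.ofReal ‖cross (truncMoment B g (Fn n)) (truncMoment B h (Fn n))‖) atTop
        (𝓝 (ENNReal.ofReal ‖cross (truncMoment B g F) (truncMoment B h F)‖)) :=
      ENNReal.tendsto_ofReal (tendsto_cross (tendsto_truncMoment hB hg hFn hpt) (tendsto_truncMoment hB hh hFn hpt)).norm
    rw [← hconv.liminf_eq]
    refine liminf_le_liminf (Eventually.of_forall fun n => ?_)
    unfold sinePhi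
    refine le_add_left ?_
    exact le_iSup_of_le g <| le_iSup_of_le h <| le_iSup_of_le hg <| le_iSup_of_le hh le_rfl
  · push Not at hpen
    obtain ⟨ζ, hζ, hlt⟩ := hpen
    have hev : ∀ᶠ n in atTop, sinePhi U B (Fn n) = ⊤ := by
      have h2 : ∀ᶠ n in atTop, B < ‖Fn n ζ‖ := (hpt ζ).norm.eventually (lt_mem_nhds hlt)
      refine h2.mono fun n hn => ?_
      have hnot : ¬ ∀ ζ' ∈ closure U, ‖Fn n ζ'‖ ≤ B := fun H => absurd hn (not_lt.2 (H ζ hζ))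
      simp only [sinePhi, capPenalty, if_neg hnot, top_add]
    have hlim : liminf (fun n => sinePhi U B (Fn n)) atTop = ⊤ := by
      rw [liminf_congr hev, liminf_const]
    rw [hlim]
    exact le_top

/-- `∫ ⟪f, c⟫ = ⟪∫ f, c⟫` (Mathlib's `integral_inner`, right slot). -/
theorem integral_inner_right {f : EuclideanSpace ℝ (Fin 3) → EuclideanSpace ℝ (Fin 3)} (hf : Integrable f)
    (c : EuclideanSpace ℝ (Fin 3)) : ∫ x, ⟪f x, c⟫ = ⟪∫ x, f x, c⟫ := by
  have h1 : (fun x => ⟪f x, c⟫) = fun x => ⟪c, f x⟫ := funext fun x => real_inner_comm _ _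
  rw [h1, integral_inner hf c, real_inner_comm]

/-! ## §3 (H2) ANALYTIC SPREAD: zero sine-moment defect on the window field of an analytic slice ⇒ unidirectional
vorticity of the whole slice -/

/-- the weak identity behind the moment: `⟪m(g, F) × w, c⟫ = ∫ g ⟪curl F × w, c⟫`, i.e.
`m(g, F) × w = ∫ g · (curl F × w)` for `F ∈ C¹`, `g ∈ C¹_c`. -/
theorem cross_vortMoment {F : EuclideanSpace ℝ (Fin 3) → EuclideanSpace ℝ (Fin 3)} (hF : ContDiff ℝ 1 F)
    {g : EuclideanSpace ℝ (Fin 3) → ℝ} (hg : ContDiff ℝ 1 g) (hgc : HasCompactSupport g) (w : EuclideanSpace ℝ (Fin 3)) :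
    cross (vortMoment g F) w = ∫ x, g x • cross (curl F x) w := by
  have hFd : Differentiable ℝ F := hF.differentiable (by simp)
  have hcurl : Continuous (curl F) := by
    rw [curl_eq_curlCLM_comp]
    exact curlCLM.continuous.comp (hF.continuous_fderiv (by simp))
  have hgrad : Continuous (gradient g) := continuous_gradient_of_contDiff hg
  -- integrability of the two vector integrands (continuous, compactly supported)
  have hsupp1 : HasCompactSupport fun x => cross (F x) (gradient g x) := by
    refine hgc.mono' fun x hx => ?_
    contrapose! hx
    simp only [mem_support, not_not]
    rw [gradient_eq_zero_off hx, ← crossCLM_apply, map_zero]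
  have hint1 : Integrable fun x => cross (F x) (gradient g x) :=
    (continuous_cross_comp hF.continuous hgrad).integrable_of_hasCompactSupport hsupp1
  have hsupp2 : HasCompactSupport fun x => g x • cross (curl F x) w := by
    refine hgc.mono' fun x hx => ?_
    contrapose! hx
    simp only [mem_support, not_not]
    rw [image_eq_zero_of_notMem_tsupport hx, zero_smul]
  have hint2 : Integrable fun x => g x • cross (curl F x) w :=
    (hg.continuous.smul (continuous_cross_comp hcurl continuous_const)).integrable_of_hasCompactSupport hsupp2
  refine ext_inner_right ℝ fun c => ?_
  calc ⟪cross (vortMoment g F) w, c⟫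
      = ⟪vortMoment g F, cross w c⟫ := (inner_cross_right_eq_inner_cross_left _ _ _).symm
    _ = ∫ x, ⟪cross (F x) (gradient g x), cross w c⟫ := (integral_inner_right hint1 _).symm
    _ = ∫ x, g x * ⟪curl F x, cross w c⟫ :=
        (integral_mul_inner_eq_integral_inner_cross_gradient hFd EventuallyEq.rfl
          (hcurl.locallyIntegrable) hg hgc _).symm
    _ = ∫ x, ⟪g x • cross (curl F x) w, c⟫ := by
        refine integral_congr_ae (Eventually.of_forall fun x => ?_)
        simp only [real_inner_smul_left, inner_cross_right_eq_inner_cross_left]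
    _ = ⟪∫ x, g x • cross (curl F x) w, c⟫ := integral_inner_right hint2 _

/-- every smooth weight compactly supported in `U` has a positive multiple in `𝒯(U)`. -/
theorem exists_smul_isTestWeight {U : Set (EuclideanSpace ℝ (Fin 3))} {g : EuclideanSpace ℝ (Fin 3) → ℝ}
    (hg : ContDiff ℝ ∞ g) (hgc : HasCompactSupport g) (hgU : tsupport g ⊆ U) :
    ∃ c : ℝ, 0 < c ∧ IsTestWeight U (fun x => c * g x) := by
  obtain ⟨C₀, hC₀⟩ := hg.continuous.bounded_above_of_compact_support hgc
  have hfc : Continuous (fderiv ℝ g) := hg.continuous_fderiv (by simp)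
  obtain ⟨C₁, hC₁⟩ := hfc.bounded_above_of_compact_support (hgc.fderiv (𝕜 := ℝ))
  set c : ℝ := 1 / (|C₀| + |C₁| + 1) with hc
  have hden : 0 < |C₀| + |C₁| + 1 := by positivity
  have hcpos : 0 < c := by rw [hc]; positivity
  refine ⟨c, hcpos, contDiff_const.mul hg, hgc.mul_left, (tsupport_mul_subset_right).trans hgU, fun x => ⟨?_, ?_⟩⟩
  · rw [abs_mul, abs_of_pos hcpos, hc, div_mul_eq_mul_div, one_mul, div_le_one hden]
    have := hC₀ x
    rw [Real.norm_eq_abs] at this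
    linarith [le_abs_self C₀, abs_nonneg C₁]
  · have hd : DifferentiableAt ℝ g x := (hg.differentiable (by simp)) x
    rw [fderiv_const_mul hd, norm_smul, Real.norm_eq_abs, abs_of_pos hcpos, hc, div_mul_eq_mul_div, one_mul,
      div_le_one hden]
    linarith [hC₁ x, le_abs_self C₁, abs_nonneg C₀]

/-- **the weak lemma**: if all vorticity moments of a `C¹` field against `𝒯(U)` are parallel to `w`, then `curl F × w = 0`
on `U`. -/
theorem cross_curl_eq_zero_of_moments {U : Set (EuclideanSpace ℝ (Fin 3))} (hU : IsOpen U)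
    {F : EuclideanSpace ℝ (Fin 3) → EuclideanSpace ℝ (Fin 3)} (hF : ContDiff ℝ 1 F) (w : EuclideanSpace ℝ (Fin 3))
    (hw : ∀ g, IsTestWeight U g → cross (vortMoment g F) w = 0) : ∀ x ∈ U, cross (curl F x) w = 0 := by
  have hcurl : Continuous (curl F) := by
    rw [curl_eq_curlCLM_comp]
    exact curlCLM.continuous.comp (hF.continuous_fderiv (by simp))
  have hf : Continuous fun x => cross (curl F x) w := continuous_cross_comp hcurl continuous_const
  have hint : ∀ g : EuclideanSpace ℝ (Fin 3) → ℝ, ContDiff ℝ ∞ g → HasCompactSupport g → tsupport g ⊆ U →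
      ∫ x, g x • cross (curl F x) w = 0 := by
    intro g hg hgc hgU
    obtain ⟨c, hc, htest⟩ := exists_smul_isTestWeight hg hgc hgU
    have h1 := hw _ htest
    rw [cross_vortMoment hF htest.contDiff htest.2.1] at h1
    have h2 : (∫ x, (c * g x) • cross (curl F x) w) = c • ∫ x, g x • cross (curl F x) w := by
      rw [← integral_smul]
      exact integral_congr_ae (Eventually.of_forall fun x => by simp only [mul_smul])
    rw [h2, smul_eq_zero] at h1
    exact h1.resolve_left hc.ne'
  have hae := hU.ae_eq_zero_of_integral_contDiff_smul_eq_zero (hf.locallyIntegrable.locallyIntegrableOn U) hint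
  have hae' : (fun x => cross (curl F x) w) =ᵐ[volume.restrict U] 0 :=
    (ae_restrict_iff' hU.measurableSet).2 hae
  have heq := Measure.eqOn_open_of_ae_eq hae' hU hf.continuousOn continuousOn_const
  exact fun x hx => heq hx

/-- pairwise-parallel vectors on a set are all parallel to one nonzero vector. -/
theorem exists_common_direction {U : Set (EuclideanSpace ℝ (Fin 3))} {G : EuclideanSpace ℝ (Fin 3) → EuclideanSpace ℝ (Fin 3)}
    (h : ∀ x ∈ U, ∀ x' ∈ U, cross (G x) (G x') = 0) :
    ∃ e : EuclideanSpace ℝ (Fin 3), e ≠ 0 ∧ ∀ x ∈ U, cross (G x) e = 0 := by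
  by_cases hex : ∃ x₁ ∈ U, G x₁ ≠ 0
  · obtain ⟨x₁, hx₁, hne⟩ := hex
    exact ⟨G x₁, hne, fun x hx => h x hx x₁ hx₁⟩
  · push Not at hex
    refine ⟨EuclideanSpace.single 0 1, ?_, fun x hx => ?_⟩
    · intro h0
      have := congrArg (fun v : EuclideanSpace ℝ (Fin 3) => v 0) h0
      simp at this
    · rw [hex x hx, ← crossCLM_apply, map_zero]
      rfl

/-- **(H2) for the sine-moment defect.** -/
theorem spreadsTo_sinePhi {ν : ℝ} (hν : 0 < ν) {U : Set (EuclideanSpace ℝ (Fin 3))} (hU : IsOpen U) (hne : U.Nonempty)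
    {B : ℝ} (hB : 0 < B) : SpreadsTo (sinePhi U B) uniStratum ν := by
  intro v s hs han hzero
  set σ : ℝ := Real.sqrt (-s) / Real.sqrt ν with hσdef
  have hσ : 0 < σ := div_pos (Real.sqrt_pos.2 (neg_pos.2 hs)) (Real.sqrt_pos.2 hν)
  set F := profileWindowField ν v s with hFdef
  have hFeq : F = fun y => (σ * ν) • v s (σ • y) := rfl
  -- the cap penalty is off and every term of the supremum vanishes
  have hpen : ∀ ζ ∈ closure U, ‖F ζ‖ ≤ B := by
    by_contra H
    simp only [sinePhi, capPenalty, if_neg H, top_add, ENNReal.top_ne_zero] at hzero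
  have hsup : (⨆ (g : EuclideanSpace ℝ (Fin 3) → ℝ) (h : EuclideanSpace ℝ (Fin 3) → ℝ) (_ : IsTestWeight U g)
      (_ : IsTestWeight U h), ENNReal.ofReal ‖cross (truncMoment B g F) (truncMoment B h F)‖) = 0 := by
    simpa only [sinePhi, capPenalty, if_pos hpen, zero_add] using hzero
  have hterm : ∀ g h, IsTestWeight U g → IsTestWeight U h → cross (truncMoment B g F) (truncMoment B h F) = 0 := by
    intro g h hg hh
    have h0 := ENNReal.iSup_eq_zero.1 (ENNReal.iSup_eq_zero.1 (ENNReal.iSup_eq_zero.1 (ENNReal.iSup_eq_zero.1 hsup g) h) hg) hh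
    rw [ENNReal.ofReal_eq_zero] at h0
    exact norm_le_zero_iff.1 h0
  -- on test weights the truncation is inactive
  have htm : ∀ g, IsTestWeight U g → truncMoment B g F = vortMoment g F := by
    intro g hg
    unfold truncMoment vortMoment
    refine integral_congr_ae (Eventually.of_forall fun x => ?_)
    by_cases hx : x ∈ tsupport g
    · simp only [truncate_of_norm_le hB (hpen x (subset_closure (hg.2.2.1 hx)))]
    · simp only [gradient_eq_zero_off hx, ← crossCLM_apply, map_zero]
  -- the window field is smooth
  have hvs : ContDiff ℝ 1 (v s) := han.contDiff
  have hF1 : ContDiff ℝ 1 F := by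
    rw [hFeq]
    exact (hvs.comp (contDiff_const_smul σ)).const_smul (σ * ν)
  -- pairwise parallel curl on the window
  have hpair : ∀ x ∈ U, ∀ x' ∈ U, cross (curl F x) (curl F x') = 0 := by
    have step1 : ∀ h, IsTestWeight U h → ∀ x ∈ U, cross (curl F x) (vortMoment h F) = 0 := by
      intro h hh
      refine cross_curl_eq_zero_of_moments hU hF1 _ fun g hg => ?_
      rw [← htm g hg, ← htm h hh]
      exact hterm g h hg hh
    intro x hx x' hx'
    have step2 : ∀ x' ∈ U, cross (curl F x') (curl F x) = 0 :=
      cross_curl_eq_zero_of_moments hU hF1 _ fun h hh => cross_eq_zero_symm (step1 h hh x hx)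
    exact cross_eq_zero_symm (step2 x' hx')
  obtain ⟨e, he, hal⟩ := exists_common_direction hpair
  -- transport to the slice `v s` on the dilated window
  have hcurlF : ∀ x, curl F x = (σ * ν * σ) • curl (v s) (σ • x) := fun x => by
    -- curl of a dilated field (the tree's `CloudFrameEffectiveTsai.curl_smul_comp_smul_apply`, inlined)
    have hD : fderiv ℝ (fun y => (σ * ν) • v s (σ • y)) x = (σ * ν * σ) • fderiv ℝ (v s) (σ • x) := by
      have h : (fun y => (σ * ν) • v s (σ • y)) = (σ * ν) • fun y => v s (σ • y) := rfl
      rw [h, fderiv_const_smul_field, Pi.smul_apply, _root_.fderiv_comp_smul, smul_smul]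
    rw [hFeq, curl_eq_curlCLM, curl_eq_curlCLM, hD, map_smul]
  have hk : σ * ν * σ ≠ 0 := by positivity
  set U' : Set (EuclideanSpace ℝ (Fin 3)) := (fun z => σ⁻¹ • z) ⁻¹' U with hU'def
  have hU' : IsOpen U' := hU.preimage (continuous_const_smul σ⁻¹)
  have hne' : U'.Nonempty := by
    obtain ⟨x₀, hx₀⟩ := hne
    refine ⟨σ • x₀, ?_⟩
    show σ⁻¹ • σ • x₀ ∈ U
    rwa [smul_smul, inv_mul_cancel₀ hσ.ne', one_smul]
  have hal' : ∀ z ∈ U', cross (curl (v s) z) e = 0 := by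
    intro z hz
    have h1 := hal (σ⁻¹ • z) hz
    rw [hcurlF, smul_smul, mul_inv_cancel₀ hσ.ne', one_smul, Summit.NavierStokesRegularity.FluidComputer.RotatingBeltramiDrift.cross_smul_left, smul_eq_zero] at h1
    exact h1.resolve_left hk
  exact ⟨e, he, cross_eq_zero_spread (analyticOnNhd_curl han) e hU' hne' hal'⟩

/-! ## §4 (H3) STRATUM LIOUVILLE for unidirectional vorticity = the tree's aligned-window rigidity (LocalSineTubeDoor 2C) -/

/-- **(H3)**: a classical solution on `(−∞,0) × ℝ³` with Type-I decay all of whose slices have unidirectional vorticity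
vanishes (`eq_zero_of_aligned_window` on the slice `s = −1`, window `ℝ³`). -/
theorem stratumLiouville_uni (D : ℝ) : StratumLiouville uniStratum D := by
  intro V q hVcl hVdec hstrat
  obtain ⟨hsm, hdiv, hmild, hrate⟩ :=
    Summit.NavierStokesRegularity.NavierStokesRegularity.Theorems.PolyhedralDssProfileExists.Birth.isTypeIAncientMild_of_classical_typeI
      hVcl hVdec
  have hcont : ContinuousOn (uncurry V) (Iio (0 : ℝ) ×ˢ univ) := hsm.continuousOn
  have hmild' : ∀ s t : ℝ, s < t → t < 0 → ∀ y : EuclideanSpace ℝ (Fin 3),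
      V t y = UnboundedOperators.heatExtension (V s) (t - s) y - oseenDuhamel 1 s V V t y := by
    intro s t hst ht y
    rw [← heatFlow_of_pos (V s) (sub_pos.2 hst)]
    exact hmild s t hst ht y
  have h10 : (-1 : ℝ) < 0 := by norm_num
  obtain ⟨e, he, hal⟩ := hstrat (-1) h10
  exact eq_zero_of_aligned_window hrate hcont hmild' hdiv h10 he isOpen_univ univ_nonempty fun y _ => hal y


end Summit.NavierStokesRegularity.NavierStokesRegularity.Theorems.SineMomentDoor

end
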